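import Summits.HodgeConjecture.HodgeConjecture.Theorems.Ring2AbelianAllWeilSignCells
import HarnessLib

/-!
# Ring 2 · AbelianAll (ab-weil-1, gen 7, part 5) — the Weil floor RE-BASED: no van Geemen 5.2
  existence binder, and only the POSITIVE half of the fourfold residual

research route, not a corollary; conditional on HC_CM plus one named minimal statement.
Cell line: research route conditional on HC_CM; not a corollary; Q11.4-sentence-2 already refuted in dim ≥ 3.
`HC_CM` (`Theses.RankFourFaces.CMAbelianHodge`) does not occur in this file; no open case of the Hodge
conjecture is claimed — every statement below keeps the refereed named facts (Koike 2004, Schoen 1998,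
Markman 2023, Moonen–Zarhin 1999) and Landherr's criterion as HYPOTHESES and an honest residual as a HYPOTHESIS.

This is the one-term re-base asked for by the hypotheses seat (typer2, part XXIX): the eight rows of
`Ring2AbelianAllWeilFloor` / `Ring2AbelianAllWeilSquarefree` that carried the typed van Geemen 5.2 (1)–(3)
obligation `(hE : PolarizedWeilDiscriminantExists)` are re-stated WITHOUT it — the obligation is a tree theorem,
`Ring2.Hypotheses.polarizedWeilDiscriminantExists_holds` (typer2) over the literature seat's
`VanGeemen1994.exists_projectiveEmbedding_hasWeilDiscriminantNondeg`. On top, part 4 of this gen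
(`weilFourfoldResidual_iff_sign`, `weilFourfoldResidualSq_iff_sign`: the negative classes are closed in the tree by
van Geemen's Lemma 5.2 (4) on the carriers) lets the floor take only the POSITIVE half of the residual.

## What is proved (0 sorry; every proof is a one-line instantiation)

* `weilAlgebraicAll_two_of_components'`, `weilAlgebraicAll_two_of_positive_components` — the unpolarized slice
  `WeilAlgebraicAll 2 d` from the components of `d` (all of them / the positive ones), no binder.
* `weilAlgebraicAll_two_sq_of_koike2004'` (`d = m²`), `weilAlgebraicAll_two_sq_mul_three_of_schoen1998'`
  (`d = 3m²`) — the two refereed columns up the squares, no binder.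
* `markmanFourfolds_of_refereed_and_residual'`, `…_residualSq'`, `weilFourfoldResidual_of_refereed_and_residualSq'`,
  `hodgeConjectureFor_abelian_dim_le_five_of_refereed_and_residual'`, `…_residualSq'` — the gen-1 / gen-4 floor rows,
  no binder.
* `hodgeConjectureFor_abelian_dim_le_five_of_refereed_and_positive_residualSq` — **THE WEIL FLOOR, sharpest form in
  the tree: HC for every complex abelian variety of dimension `≤ 5` from the refereed named facts, Landherr's
  criterion, and the POSITIVE SQUAREFREE residual** `∀ d squarefree ∉ {1,3}, ∀ δ ≠ [1] with weilSign d δ = 1,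
  WeilClassesComponent 2 d δ` (the only remaining unrefereed print input: Markman 2025 Cor. 1.6.1).

## References

* [vanGeemen1994HodgeAV] B. van Geemen, LNM 1594 (1994), Lemma 5.2 (1)–(4), 4.14.
* [MoonenZarhin1999LowDim] Moonen–Zarhin, Thm. 0.1, 0.2, (2.7). [Koike2004WeilHodge] Rem. 2.1.
  [Schoen1998HodgeWeilAddendum] §10. [Markman2023GeneralizedKummers] Thm. 1.5 (= 13.4, p. 236; pre-v4 arXiv: Thm. 1.3).
* [Markman2025SecantWeil] E. Markman, arXiv:2502.03415 (preprint, unrefereed), Cor. 1.6.1; [Markman2025SurveySecant] Thm. 1.2.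
-/

set_option linter.dupNamespace false

open CategoryTheory
open Literature.AlgebraicGeometry Literature.AlgebraicGeometry.Motives
open Literature.AlgebraicGeometry.HodgeTheory
open Literature.AlgebraicGeometry.VanGeemen1994
open Literature.AlgebraicTopology.SingularHomology
open Summit.HodgeConjecture.HodgeConjecture.WeilTypeLadder
open Summit.HodgeConjecture.HodgeConjecture.Ring2.Hypotheses
open Summit.HodgeConjecture.HodgeConjecture.Ring2.Habitat
open Summit.HodgeConjecture.HodgeConjecture.Cruxes.HodgeAbelianVarieties.EStepSecantInduction
open Summit.HodgeConjecture.HodgeConjecture.Cruxes.HodgeAbelianVarieties.PrymCanonicalZ3SplitSeeds.Stubs.WeilSectorOffReach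

namespace Summit.HodgeConjecture.HodgeConjecture.Ring2.AbelianAll

/-! ### §6 The floor rows without the van Geemen 5.2 existence binder -/

/-- **Components ⇒ the unpolarized slice `WeilAlgebraicAll 2 d`**, NO binder (van Geemen 5.2 (1)–(3) is the
tree theorem `polarizedWeilDiscriminantExists_holds`). [cite: vanGeemen1994HodgeAV, Lemma 5.2 (1)–(3)] -/
theorem weilAlgebraicAll_two_of_components' {d : ℕ} (hd : 0 < d)
    (h : ∀ δ : weilNormResidueGroup d, WeilClassesComponent 2 d δ) : WeilAlgebraicAll 2 d :=
  weilAlgebraicAll_two_of_components polarizedWeilDiscriminantExists_holds hd h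

/-- **Positive components ⇒ the unpolarized slice `WeilAlgebraicAll 2 d`**: the negative classes are closed
in the tree (part 4, Lemma 5.2 (4) on the carriers). [cite: vanGeemen1994HodgeAV, Lemma 5.2 (1)–(4) and 4.14] -/
theorem weilAlgebraicAll_two_of_positive_components {d : ℕ} (hd : 0 < d)
    (h : ∀ δ : weilNormResidueGroup d, weilSign d δ = 1 → WeilClassesComponent 2 d δ) : WeilAlgebraicAll 2 d :=
  weilAlgebraicAll_two_of_components' hd
    ((forall_weilClassesComponent_iff_sign two_pos hd).2 fun δ hδ => h δ (hδ.trans (by decide : Even 2).neg_one_pow))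

/-- `WeilAlgebraicAll 2 (m²)` (`K = ℚ(i)`) from Koike 2004 (refereed) alone — no van Geemen binder.
[cite: Koike2004WeilHodge, Rem. 2.1] [cite: vanGeemen1994HodgeAV, Lemma 5.2 (1)–(3)] -/
theorem weilAlgebraicAll_two_sq_of_koike2004' (hK : Koike2004_weilClasses_algebraic_hyperbolicSixfold_one)
    {m : ℕ} (hm : m ≠ 0) : WeilAlgebraicAll 2 (m ^ 2) :=
  weilAlgebraicAll_two_sq_of_koike2004 hK polarizedWeilDiscriminantExists_holds hm

/-- `WeilAlgebraicAll 2 (3m²)` (`K = ℚ(√-3)`) from Schoen 1998 (refereed) alone — no van Geemen binder.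
[cite: Schoen1998HodgeWeilAddendum, §10] [cite: vanGeemen1994HodgeAV, Lemma 5.2 (1)–(3)] -/
theorem weilAlgebraicAll_two_sq_mul_three_of_schoen1998'
    (hS : Schoen1998_weilClasses_algebraic_hyperbolicSixfold_three) {m : ℕ} (hm : m ≠ 0) :
    WeilAlgebraicAll 2 (m ^ 2 * 3) :=
  weilAlgebraicAll_two_sq_mul_three_of_schoen1998 hS polarizedWeilDiscriminantExists_holds hm

/-- **Markman's fourfold STATEMENT from refereed facts + Landherr + the residual**, no van Geemen binder.
[cite: Markman2025SurveySecant, Thm. 1.2 (statement only; preprint)] -/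
theorem markmanFourfolds_of_refereed_and_residual'
    (hK : Koike2004_weilClasses_algebraic_hyperbolicSixfold_one)
    (hS : Schoen1998_weilClasses_algebraic_hyperbolicSixfold_three)
    (hL : LandherrSplitCriterion) (hM23 : Markman2023_weilClasses_algebraic_discOneWeilFourfold)
    (hR : WeilFourfoldResidual) : Markman2025_weilClasses_algebraic_abelianFourfold :=
  markmanFourfolds_of_refereed_and_residual hK hS hL hM23 polarizedWeilDiscriminantExists_holds hR

/-- Same with the squarefree residual, no van Geemen binder. [cite: Markman2025SurveySecant, Thm. 1.2 (statement only; preprint)] -/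
theorem markmanFourfolds_of_refereed_and_residualSq'
    (hK : Koike2004_weilClasses_algebraic_hyperbolicSixfold_one)
    (hS : Schoen1998_weilClasses_algebraic_hyperbolicSixfold_three)
    (hL : LandherrSplitCriterion) (hM23 : Markman2023_weilClasses_algebraic_discOneWeilFourfold)
    (hR : WeilFourfoldResidualSq) : Markman2025_weilClasses_algebraic_abelianFourfold :=
  markmanFourfolds_of_refereed_and_residualSq hK hS hL hM23 polarizedWeilDiscriminantExists_holds hR

/-- The squarefree residual gives back the old one, granted the refereed facts and Landherr only.
[cite: vanGeemen1994HodgeAV, Lemma 5.2 (1)–(3)] -/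
theorem weilFourfoldResidual_of_refereed_and_residualSq'
    (hK : Koike2004_weilClasses_algebraic_hyperbolicSixfold_one)
    (hS : Schoen1998_weilClasses_algebraic_hyperbolicSixfold_three)
    (hL : LandherrSplitCriterion) (hM23 : Markman2023_weilClasses_algebraic_discOneWeilFourfold)
    (hR : WeilFourfoldResidualSq) : WeilFourfoldResidual :=
  weilFourfoldResidual_of_refereed_and_residualSq hK hS hL hM23 polarizedWeilDiscriminantExists_holds hR

/-- **THE WEIL FLOOR (dimension `≤ 5`)** from the refereed named facts, Landherr's criterion and the residual
`WeilFourfoldResidual` — no van Geemen binder. `HC_CM` absent; no minimality claimed; research route, not a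
corollary. [cite: MoonenZarhin1999LowDim, Thm. 0.1, 0.2 and (2.7)] [cite: Markman2023GeneralizedKummers, Thm. 1.5]
[cite: Schoen1998HodgeWeilAddendum, §10] [cite: Koike2004WeilHodge, Rem. 2.1] -/
theorem hodgeConjectureFor_abelian_dim_le_five_of_refereed_and_residual'
    (hred : MoonenZarhin1999_hodgeClasses_abelian_dim_le_five_of_weilClassesFourfolds)
    (hK : Koike2004_weilClasses_algebraic_hyperbolicSixfold_one)
    (hS : Schoen1998_weilClasses_algebraic_hyperbolicSixfold_three)
    (hL : LandherrSplitCriterion) (hM23 : Markman2023_weilClasses_algebraic_discOneWeilFourfold)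
    (hR : WeilFourfoldResidual) (A : AbelianVariety ℂ) (hA : A.dim ≤ 5) : HodgeConjectureFor A.dim A.X :=
  hodgeConjectureFor_abelian_dim_le_five_of_refereed_and_residual hred hK hS hL hM23
    polarizedWeilDiscriminantExists_holds hR A hA

/-- **THE WEIL FLOOR (dimension `≤ 5`) with the squarefree residual** — no van Geemen binder.
[cite: MoonenZarhin1999LowDim, Thm. 0.1, 0.2 and (2.7)] [cite: Markman2023GeneralizedKummers, Thm. 1.5]
[cite: Schoen1998HodgeWeilAddendum, §10] [cite: Koike2004WeilHodge, Rem. 2.1] -/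
theorem hodgeConjectureFor_abelian_dim_le_five_of_refereed_and_residualSq'
    (hred : MoonenZarhin1999_hodgeClasses_abelian_dim_le_five_of_weilClassesFourfolds)
    (hK : Koike2004_weilClasses_algebraic_hyperbolicSixfold_one)
    (hS : Schoen1998_weilClasses_algebraic_hyperbolicSixfold_three)
    (hL : LandherrSplitCriterion) (hM23 : Markman2023_weilClasses_algebraic_discOneWeilFourfold)
    (hR : WeilFourfoldResidualSq) (A : AbelianVariety ℂ) (hA : A.dim ≤ 5) : HodgeConjectureFor A.dim A.X :=
  hodgeConjectureFor_abelian_dim_le_five_of_refereed_and_residualSq hred hK hS hL hM23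
    polarizedWeilDiscriminantExists_holds hR A hA

/-! ### §7 The floor from the POSITIVE squarefree residual -/

/-- **THE WEIL FLOOR, sharpest form in the tree**: the Hodge conjecture for every complex abelian variety of
dimension `≤ 5` from the refereed named facts (Moonen–Zarhin 1999, Koike 2004, Schoen 1998, Markman 2023),
Landherr's criterion, and the POSITIVE SQUAREFREE residual — the cells `(2, d, δ)` with `d` squarefree,
`d ∉ {1, 3}`, `δ ≠ [1]` and `weilSign d δ = 1` (the negative classes are closed in the tree by van Geemen's
Lemma 5.2 (4) on the carriers; the non-squarefree `d` by the gen-4 isogeny descent). In print the residual is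
Markman 2025 Cor. 1.6.1 (unrefereed). `HC_CM` absent; no minimality claimed; research route, not a corollary.
[cite: MoonenZarhin1999LowDim, Thm. 0.1, 0.2 and (2.7)] [cite: vanGeemen1994HodgeAV, Lemma 5.2 (4) and 4.14]
[cite: Markman2025SecantWeil, Cor. 1.6.1 (preprint, unrefereed)] -/
theorem hodgeConjectureFor_abelian_dim_le_five_of_refereed_and_positive_residualSq
    (hred : MoonenZarhin1999_hodgeClasses_abelian_dim_le_five_of_weilClassesFourfolds)
    (hK : Koike2004_weilClasses_algebraic_hyperbolicSixfold_one)
    (hS : Schoen1998_weilClasses_algebraic_hyperbolicSixfold_three)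
    (hL : LandherrSplitCriterion) (hM23 : Markman2023_weilClasses_algebraic_discOneWeilFourfold)
    (hR : ∀ d : ℕ, 0 < d → Squarefree d → d ≠ 1 → d ≠ 3 → ∀ δ : weilNormResidueGroup d,
      δ ≠ splitDiscriminantClass 2 d → weilSign d δ = 1 → WeilClassesComponent 2 d δ)
    (A : AbelianVariety ℂ) (hA : A.dim ≤ 5) : HodgeConjectureFor A.dim A.X :=
  hodgeConjectureFor_abelian_dim_le_five_of_refereed_and_residualSq' hred hK hS hL hM23
    (weilFourfoldResidualSq_iff_sign.2 hR) A hA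

/-- **Markman's fourfold statement from the POSITIVE squarefree residual** (refereed facts + Landherr).
[cite: Markman2025SurveySecant, Thm. 1.2 (statement only; preprint)] [cite: vanGeemen1994HodgeAV, Lemma 5.2 (4)] -/
theorem markmanFourfolds_of_refereed_and_positive_residualSq
    (hK : Koike2004_weilClasses_algebraic_hyperbolicSixfold_one)
    (hS : Schoen1998_weilClasses_algebraic_hyperbolicSixfold_three)
    (hL : LandherrSplitCriterion) (hM23 : Markman2023_weilClasses_algebraic_discOneWeilFourfold)
    (hR : ∀ d : ℕ, 0 < d → Squarefree d → d ≠ 1 → d ≠ 3 → ∀ δ : weilNormResidueGroup d,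
      δ ≠ splitDiscriminantClass 2 d → weilSign d δ = 1 → WeilClassesComponent 2 d δ) :
    Markman2025_weilClasses_algebraic_abelianFourfold :=
  markmanFourfolds_of_refereed_and_residualSq' hK hS hL hM23 (weilFourfoldResidualSq_iff_sign.2 hR)

end Summit.HodgeConjecture.HodgeConjecture.Ring2.AbelianAll
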